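import Summits.HubbardSuperconductivity.HubbardSuperconductivity.Theorems.AnisotropyChordTransferFibre3FinX3Eval

/-!
# Route `AnisotropyChord` / H0 rotor rung: FIN per-`L` GM₃ (X5), `L = 34` — rows `N₁` / D / side-condition cell facts, part `p21`

Kernel facts (`decide +kernel`) for cert cells 62, 63 of the per-`L` grid of `L = 34`: `xbnCellAny2` (row `N₁` on XB2 point wedges recomputed in the kernel, exporting the literal brackets `nt ⊇ T⁺ − 3λ₂` and `tb ⊇ T⁺·D`), `xdCellAnyN0` (row D, reads `nt`), `sdCellAnyZN` (side condition, reads `nt`); evaluators `…FinX3Eval` / `…FinX5Eval`; constants from the compiled design probe (x3probe/x3plan, margins c ×0.985, b ×1.03, aD ×1.03); assembled in `…FinX5GM3ThirtyFour`.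
Prover seat `hubbard-h0-rotor-p3` g8; helper for piece A = stmt-HubbardSuperconductivity-23918 of rung 19089 (`--supports`, helper class).
WHAT THIS IS NOT: nothing here proves superconductivity in the Hubbard model (rotor TARGET as worded stays FALSE, g15 verdict); kernel facts for the FIN certificate of ONE conditional reduction.  Tree imports only; zero data; standard axioms.
-/

set_option linter.dupNamespace false
set_option autoImplicit false

namespace Summit.HubbardSuperconductivity.HubbardSuperconductivity.Theorems.AnisotropyChord.Transfer.Fibre3

namespace FinXD

open FinXB FinCell Hole2

set_option maxHeartbeats 4000000 in
/-- row `N₁` of cell 62 of `L = 34` (`c = 61/100`), exporting `nt`, `tb`. [folklore] -/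
theorem xn34_62 : xbnCellAny2 34 (49/50 : ℚ) 208485644163566 213697785267656 (61/100 : ℚ) ((-925501976148 : ℤ), (1393936856558 : ℤ)) ((624527613028390 : ℤ), (642491110145686 : ℤ)) = true := by decide +kernel

set_option maxHeartbeats 4000000 in
/-- row D of cell 62 of `L = 34` (`aD = 17/200`). [folklore] -/
theorem xd34_62 : xdCellAnyN0 34 (49/50 : ℚ) 208485644163566 213697785267656 (17/200 : ℚ) ((-925501976148 : ℤ), (1393936856558 : ℤ)) = true := by decide +kernel

set_option maxHeartbeats 4000000 in
/-- side condition of cell 62 of `L = 34` (`c, b = 59/100, aD`). [folklore] -/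
theorem sd34_62 : sdCellAnyZN 34 (49/50 : ℚ) 100 208485644163566 213697785267656 ((61/100 : ℚ), (59 : ℕ), (17/200 : ℚ)) ((-925501976148 : ℤ), (1393936856558 : ℤ)) = true := by decide +kernel

set_option maxHeartbeats 4000000 in
/-- row `N₁` of cell 63 of `L = 34` (`c = 61/100`), exporting `nt`, `tb`. [folklore] -/
theorem xn34_63 : xbnCellAny2 34 (49/50 : ℚ) 213697785267656 219040229899348 (61/100 : ℚ) ((-903970757329 : ℤ), (1408572121356 : ℤ)) ((640185472122325 : ℤ), (658533174742714 : ℤ)) = true := by decide +kernel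

set_option maxHeartbeats 4000000 in
/-- row D of cell 63 of `L = 34` (`aD = 17/200`). [folklore] -/
theorem xd34_63 : xdCellAnyN0 34 (49/50 : ℚ) 213697785267656 219040229899348 (17/200 : ℚ) ((-903970757329 : ℤ), (1408572121356 : ℤ)) = true := by decide +kernel

set_option maxHeartbeats 4000000 in
/-- side condition of cell 63 of `L = 34` (`c, b = 59/100, aD`). [folklore] -/
theorem sd34_63 : sdCellAnyZN 34 (49/50 : ℚ) 100 213697785267656 219040229899348 ((61/100 : ℚ), (59 : ℕ), (17/200 : ℚ)) ((-903970757329 : ℤ), (1408572121356 : ℤ)) = true := by decide +kernel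

end FinXD

end Summit.HubbardSuperconductivity.HubbardSuperconductivity.Theorems.AnisotropyChord.Transfer.Fibre3
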